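import Literature.NumberTheory.GaloisRepresentations.ContinuousCohomologyTowerLimit
import HarnessLib

/-!
# Continuous `H²` of an inverse limit of discrete modules, II: injectivity (Mittag-Leffler)

Sequel to `ContinuousCohomologyTowerLimit.lean`.  For a topological representation `X` of a
locally compact group `G` presented as the limit of an `ℕ`-tower of DISCRETE representations `X_i`
with surjective transition maps (`P : DiscreteTowerPresentation X`), the comparison map
`H²(G, X) → lim_{← i} H²(G, X_i)` (`P.toLimitClasses`, surjective by part I) is **injective** as
soon as the groups `H¹(G, X_i)` are finite (`toLimitClasses_injective`), so that
**`H²(G, lim_{← i} X_i) ≅ lim_{← i} H²(G, X_i)`** (`limitClassesEquiv`).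

This is the Mittag-Leffler half of Neukirch–Schmidt–Wingberg, *Cohomology of Number Fields*
(2008), Thm. (2.7.5) / Cor. (2.7.6) in degree `2` (the kernel of the comparison map is
`lim¹_i H¹(G, X_i)`, which vanishes for finite `H¹`).  Proof, on continuous inhomogeneous cochains:
if the continuous `2`-cocycle `z` of `X` bounds at every level, the sets `Y_i` of continuous
`1`-cochains `b_i : G → X_i` with `∂ b_i = z_i` are torsors under the continuous crossed
homomorphisms; the images `J_k(i) ⊆ Y_i` of `Y_{i+k}` decrease with `k` and are saturated for the
finite-valued class map `Y_i → H¹(G, X_i)`, `b ↦ [b - b⁰]` (principal crossed homomorphisms lift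
along the surjections `X_{i+1} → X_i`), hence stabilise (`J_stable`); the stable images form a
system with SURJECTIVE transitions (`image_Jinf`), so a compatible family `(b_i)` with
`∂ b_i = z_i` exists, and it glues to a continuous `b : G → X` with `∂ b = z`.

## References

* J. Neukirch, A. Schmidt, K. Wingberg, *Cohomology of Number Fields*, 2nd ed. (2008), II §7,
  (2.7.3)–(2.7.6). [NeukirchSchmidtWingberg2008]
* J.-P. Serre, *Galois Cohomology* (1997), I §2.2–2.3. [SerreGaloisCohomology1997]
-/

noncomputable section

open CategoryTheory Function Set

universe u v

namespace Literature.NumberTheory.GaloisRepresentations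

open TopRep ContRepresentation ContinuousCohomology

namespace DiscreteTowerPresentation

variable {R : Type u} [CommRing R] [TopologicalSpace R]
variable {G : Type v} [Group G] [TopologicalSpace G] [IsTopologicalGroup G]
variable {X : TopRep.{v} R G} (P : DiscreteTowerPresentation X) (z : contTwoCocycles X)

/-! ### The torsors `Y_i = {b_i | ∂ b_i = z_i}` and their transition maps -/

/-- `Y_i`: the continuous `1`-cochains `b : G → X_i` bounding the projection `z_i` of the
`2`-cocycle `z` of `X` (`z_i = ∂ b`). [cite: NeukirchSchmidtWingberg2008, Thm (2.7.5)] -/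
def Y (i : ℕ) : Set C(G, P.obj i) :=
  {b | ∀ σ τ : G, (P.proj i).hom (z.1 (σ, τ)) = (P.obj i).ρ σ (b τ) - b (σ * τ) + b σ}

omit [IsTopologicalGroup G] in
/-- Membership in `Y_i`. [cite: NeukirchSchmidtWingberg2008, Thm (2.7.5)] -/
theorem mem_Y_iff (i : ℕ) (b : C(G, P.obj i)) :
    b ∈ P.Y z i ↔ ∀ σ τ : G, (P.proj i).hom (z.1 (σ, τ)) = (P.obj i).ρ σ (b τ) - b (σ * τ) + b σ :=
  Iff.rfl

/-- The transition map on `1`-cochains, `b ↦ tr_i ∘ b`.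
[cite: NeukirchSchmidtWingberg2008, Thm (2.7.5)] -/
def T (i : ℕ) (b : C(G, P.obj (i + 1))) : C(G, P.obj i) := ((P.tr i).hom : C(_, _)).comp b

omit [IsTopologicalGroup G] in
/-- Unfolding `T`. [cite: NeukirchSchmidtWingberg2008, Thm (2.7.5)] -/
@[simp] theorem T_apply (i : ℕ) (b : C(G, P.obj (i + 1))) (g : G) : P.T i b g = (P.tr i).hom (b g) :=
  rfl

omit [IsTopologicalGroup G] in
/-- The transition maps carry `Y_{i+1}` into `Y_i`. [cite: NeukirchSchmidtWingberg2008, Thm (2.7.5)] -/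
theorem T_mem_Y {i : ℕ} {b : C(G, P.obj (i + 1))} (hb : b ∈ P.Y z (i + 1)) : P.T i b ∈ P.Y z i := by
  intro σ τ
  rw [T_apply, T_apply, T_apply, ← TopRep.hom_comm_apply, ← P.tr_proj i, hb σ τ, map_add, map_sub]

/-- The principal crossed homomorphism `g ↦ g v - v` of `X_i`, as a continuous `1`-cochain.
[cite: SerreGaloisCohomology1997, I §2.2] -/
def principal (i : ℕ) (v : P.obj i) : C(G, P.obj i) :=
  ⟨fun g => (P.obj i).ρ g v - v,
    ((P.continuous_action i).comp (continuous_id.prodMk continuous_const)).sub continuous_const⟩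

omit [IsTopologicalGroup G] in
/-- Unfolding `principal`. [cite: SerreGaloisCohomology1997, I §2.2] -/
@[simp] theorem principal_apply (i : ℕ) (v : P.obj i) (g : G) :
    P.principal i v g = (P.obj i).ρ g v - v := rfl

omit [IsTopologicalGroup G] in
/-- `Y_i` is stable under adding principal crossed homomorphisms (`∂` kills them).
[cite: NeukirchSchmidtWingberg2008, Thm (2.7.5)] -/
theorem add_principal_mem_Y {i : ℕ} {b : C(G, P.obj i)} (hb : b ∈ P.Y z i) (v : P.obj i) :
    b + P.principal i v ∈ P.Y z i := by
  intro σ τ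
  rw [hb σ τ]
  simp only [ContinuousMap.add_apply, principal_apply, map_add, map_sub]
  have hmul : (P.obj i).ρ σ ((P.obj i).ρ τ v) = (P.obj i).ρ (σ * τ) v := by
    rw [_root_.map_mul]; rfl
  rw [hmul]
  abel

omit [IsTopologicalGroup G] in
/-- The transition map of a principal crossed homomorphism is principal.
[cite: NeukirchSchmidtWingberg2008, Thm (2.7.5)] -/
theorem T_principal (i : ℕ) (v : P.obj (i + 1)) :
    P.T i (P.principal (i + 1) v) = P.principal i ((P.tr i).hom v) := by
  ext g
  rw [T_apply, principal_apply, principal_apply, map_sub, TopRep.hom_comm_apply]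

omit [IsTopologicalGroup G] in
/-- `T` is additive. [cite: NeukirchSchmidtWingberg2008, Thm (2.7.5)] -/
theorem T_add (i : ℕ) (b b' : C(G, P.obj (i + 1))) : P.T i (b + b') = P.T i b + P.T i b' := by
  ext g
  simp only [T_apply, ContinuousMap.add_apply, map_add]

/-- The difference of two elements of `Y_i` is a continuous crossed homomorphism.
[cite: NeukirchSchmidtWingberg2008, Thm (2.7.5)] -/
def diffCocycle {i : ℕ} {b b' : C(G, P.obj i)} (hb : b ∈ P.Y z i) (hb' : b' ∈ P.Y z i) :
    contOneCocycles (P.obj i) :=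
  ⟨b' - b, fun g h => by
    have h1 := hb g h
    have h2 := hb' g h
    simp only [ContinuousMap.sub_apply, map_sub]
    have h3 : (P.obj i).ρ g (b' h) - b' (g * h) + b' g = (P.obj i).ρ g (b h) - b (g * h) + b g :=
      h2.symm.trans h1
    -- solve for `b' (g * h)`
    have h4 : b' (g * h) = (P.obj i).ρ g (b' h) + b' g -
        ((P.obj i).ρ g (b' h) - b' (g * h) + b' g) := by abel
    rw [h3] at h4
    rw [h4]
    abel⟩

omit [IsTopologicalGroup G] in
/-- Unfolding `diffCocycle`. [cite: NeukirchSchmidtWingberg2008, Thm (2.7.5)] -/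
@[simp] theorem diffCocycle_apply {i : ℕ} {b b' : C(G, P.obj i)} (hb : b ∈ P.Y z i)
    (hb' : b' ∈ P.Y z i) (g : G) : (P.diffCocycle z hb hb').1 g = b' g - b g := rfl

/-- **Equal classes ⇒ principal difference**: if `[b' - b⁰] = [b - b⁰]` in `H¹(G, X_i)` then
`b' - b` is principal. [cite: NeukirchSchmidtWingberg2008, Thm (2.7.5)] -/
theorem exists_principal_of_class_eq {i : ℕ} {b₀ b b' : C(G, P.obj i)} (h₀ : b₀ ∈ P.Y z i)
    (hb : b ∈ P.Y z i) (hb' : b' ∈ P.Y z i)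
    (h : oneCocycleClass (P.obj i) (P.diffCocycle z h₀ hb') =
      oneCocycleClass (P.obj i) (P.diffCocycle z h₀ hb)) :
    ∃ v : P.obj i, b' = b + P.principal i v := by
  rw [← sub_eq_zero, ← oneCocycleClass_sub, oneCocycleClass_eq_zero_iff] at h
  obtain ⟨v, hv⟩ := h
  refine ⟨v, ContinuousMap.ext fun g => ?_⟩
  have h1 := hv g
  change (b' g - b₀ g) - (b g - b₀ g) = _ at h1
  rw [ContinuousMap.add_apply, principal_apply, ← h1]
  abel

/-! ### The decreasing images `J_k(i)` of `Y_{i+k}` in `Y_i` -/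

/-- `J_k(i) ⊆ Y_i`: the image of `Y_{i+k}` under the `k`-fold transition, defined by peeling at the
bottom (`J_0(i) = Y_i`, `J_{k+1}(i) = tr_i ∘ J_k(i+1)`).
[cite: NeukirchSchmidtWingberg2008, Thm (2.7.5)] -/
def J : ℕ → ∀ i : ℕ, Set C(G, P.obj i)
  | 0 => fun i => P.Y z i
  | k + 1 => fun i => P.T i '' J k (i + 1)

omit [IsTopologicalGroup G] in
/-- `J_0(i) = Y_i`. [cite: NeukirchSchmidtWingberg2008, Thm (2.7.5)] -/
@[simp] theorem J_zero (i : ℕ) : P.J z 0 i = P.Y z i := rfl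

omit [IsTopologicalGroup G] in
/-- `J_{k+1}(i) = tr_i ∘ J_k(i+1)`. [cite: NeukirchSchmidtWingberg2008, Thm (2.7.5)] -/
theorem J_succ (k i : ℕ) : P.J z (k + 1) i = P.T i '' P.J z k (i + 1) := rfl

omit [IsTopologicalGroup G] in
/-- `J_k(i) ⊆ Y_i`. [cite: NeukirchSchmidtWingberg2008, Thm (2.7.5)] -/
theorem J_subset_Y : ∀ k i, P.J z k i ⊆ P.Y z i
  | 0, _ => subset_rfl
  | k + 1, i => by
    rw [J_succ]
    rintro _ ⟨b, hb, rfl⟩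
    exact P.T_mem_Y z (J_subset_Y k (i + 1) hb)

omit [IsTopologicalGroup G] in
/-- The images decrease: `J_{k+1}(i) ⊆ J_k(i)`. [cite: NeukirchSchmidtWingberg2008, Thm (2.7.5)] -/
theorem J_succ_subset : ∀ k i, P.J z (k + 1) i ⊆ P.J z k i
  | 0, i => by
    rw [J_succ, J_zero, J_zero]
    rintro _ ⟨b, hb, rfl⟩
    exact P.T_mem_Y z hb
  | k + 1, i => by
    rw [J_succ, J_succ (k := k)]
    exact image_mono (J_succ_subset k (i + 1))

omit [IsTopologicalGroup G] in
/-- `k ↦ J_k(i)` is antitone. [cite: NeukirchSchmidtWingberg2008, Thm (2.7.5)] -/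
theorem J_antitone (i : ℕ) : Antitone fun k => P.J z k i :=
  antitone_nat_of_succ_le fun k => P.J_succ_subset z k i

omit [IsTopologicalGroup G] in
/-- The images are nonempty when every `Y_i` is.
[cite: NeukirchSchmidtWingberg2008, Thm (2.7.5)] -/
theorem J_nonempty (hY : ∀ i, (P.Y z i).Nonempty) : ∀ k i, (P.J z k i).Nonempty
  | 0, i => hY i
  | k + 1, i => by
    rw [J_succ]
    exact (J_nonempty hY k (i + 1)).image _

omit [IsTopologicalGroup G] in
/-- **Saturation**: `J_k(i)` is a union of fibres of the class map `b ↦ [b - b⁰]`, i.e. it is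
stable under adding principal crossed homomorphisms (they lift along the surjective transitions).
[cite: NeukirchSchmidtWingberg2008, Thm (2.7.5)] -/
theorem add_principal_mem_J : ∀ (k i : ℕ) {b : C(G, P.obj i)}, b ∈ P.J z k i →
    ∀ v : P.obj i, b + P.principal i v ∈ P.J z k i
  | 0, _, _, hb, v => P.add_principal_mem_Y z hb v
  | k + 1, i, _, hb, v => by
    rw [J_succ] at hb ⊢
    obtain ⟨y, hy, rfl⟩ := hb
    obtain ⟨v', rfl⟩ := P.tr_surjective i v
    exact ⟨y + P.principal (i + 1) v', add_principal_mem_J k (i + 1) hy v',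
      by rw [T_add, T_principal]⟩

/-! ### Stabilisation (finiteness of `H¹`) and the Mittag-Leffler step -/

/-- The set of classes `[b - b⁰] ∈ H¹(G, X_i)` realised by `J_k(i)`, for a base point `b⁰ ∈ Y_i`.
[cite: NeukirchSchmidtWingberg2008, Thm (2.7.5)] -/
def classesOf {i : ℕ} {b₀ : C(G, P.obj i)} (h₀ : b₀ ∈ P.Y z i) (k : ℕ) :
    Set (continuousCohomology 1 (P.obj i)) :=
  {x | ∃ (b : C(G, P.obj i)) (hb : b ∈ P.J z k i),
    oneCocycleClass (P.obj i) (P.diffCocycle z h₀ (P.J_subset_Y z k i hb)) = x}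

/-- `J_k(i)` is recovered from its set of classes (saturation).
[cite: NeukirchSchmidtWingberg2008, Thm (2.7.5)] -/
theorem mem_J_iff_class_mem {i : ℕ} {b₀ : C(G, P.obj i)} (h₀ : b₀ ∈ P.Y z i) (k : ℕ)
    {b : C(G, P.obj i)} (hb : b ∈ P.Y z i) :
    b ∈ P.J z k i ↔ oneCocycleClass (P.obj i) (P.diffCocycle z h₀ hb) ∈ P.classesOf z h₀ k := by
  constructor
  · intro h
    exact ⟨b, h, rfl⟩
  · rintro ⟨b', hb', he⟩
    obtain ⟨v, rfl⟩ := P.exists_principal_of_class_eq z h₀ (P.J_subset_Y z k i hb') hb he.symm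
    exact P.add_principal_mem_J z k i hb' v

/-- `k ↦ classesOf k` is antitone. [cite: NeukirchSchmidtWingberg2008, Thm (2.7.5)] -/
theorem classesOf_antitone {i : ℕ} {b₀ : C(G, P.obj i)} (h₀ : b₀ ∈ P.Y z i) :
    Antitone (P.classesOf z h₀) := by
  intro k l hkl x
  rintro ⟨b, hb, rfl⟩
  exact ⟨b, P.J_antitone z i hkl hb, rfl⟩

/-- **Stabilisation** of the images `J_k(i)` in `k`, when `H¹(G, X_i)` is finite (the decreasing
chain of finite sets of realised classes is eventually constant).
[cite: NeukirchSchmidtWingberg2008, Cor (2.7.6)] -/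
theorem J_stable (i : ℕ) [Finite (continuousCohomology 1 (P.obj i))] (hY : (P.Y z i).Nonempty) :
    ∃ N, ∀ k, N ≤ k → P.J z N i = P.J z k i := by
  obtain ⟨b₀, h₀⟩ := hY
  obtain ⟨N, hN⟩ := WellFoundedLT.antitone_chain_condition (P.classesOf_antitone z h₀)
  refine ⟨N, fun k hk => Set.ext fun b => ?_⟩
  by_cases hb : b ∈ P.Y z i
  · rw [P.mem_J_iff_class_mem z h₀ N hb, P.mem_J_iff_class_mem z h₀ k hb, hN k hk]
  · exact ⟨fun h => (hb (P.J_subset_Y z N i h)).elim, fun h => (hb (P.J_subset_Y z k i h)).elim⟩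

/-- The stable image `J_∞(i) = ⋂_k J_k(i)`. [cite: NeukirchSchmidtWingberg2008, Thm (2.7.5)] -/
def Jinf (i : ℕ) : Set C(G, P.obj i) := ⋂ k, P.J z k i

omit [IsTopologicalGroup G] in
/-- `J_∞(i) ⊆ Y_i`. [cite: NeukirchSchmidtWingberg2008, Thm (2.7.5)] -/
theorem Jinf_subset_Y (i : ℕ) : P.Jinf z i ⊆ P.Y z i :=
  (iInter_subset _ 0).trans (P.J_subset_Y z 0 i)

omit [IsTopologicalGroup G] in
/-- If the chain is stable from `N` on, `J_∞(i) = J_k(i)` for every `k ≥ N`.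
[cite: NeukirchSchmidtWingberg2008, Thm (2.7.5)] -/
theorem Jinf_eq_of_stable {i N : ℕ} (hN : ∀ k, N ≤ k → P.J z N i = P.J z k i) {k : ℕ}
    (hk : N ≤ k) : P.Jinf z i = P.J z k i := by
  apply le_antisymm (iInter_subset _ k)
  refine subset_iInter fun l => ?_
  rw [← hN k hk]
  rcases le_total N l with h | h
  · rw [hN l h]
  · exact P.J_antitone z i h

variable (hfin : ∀ i, Finite (continuousCohomology 1 (P.obj i))) (hY : ∀ i, (P.Y z i).Nonempty)
include hfin hY

/-- `J_∞(i)` is nonempty (finite `H¹`). [cite: NeukirchSchmidtWingberg2008, Cor (2.7.6)] -/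
theorem Jinf_nonempty (i : ℕ) : (P.Jinf z i).Nonempty := by
  haveI := hfin i
  obtain ⟨N, hN⟩ := P.J_stable z i (hY i)
  rw [P.Jinf_eq_of_stable z hN le_rfl]
  exact P.J_nonempty z hY N i

/-- **Mittag-Leffler step**: the stable images have SURJECTIVE transitions,
`tr_i ∘ J_∞(i+1) = J_∞(i)`. [cite: NeukirchSchmidtWingberg2008, Cor (2.7.6)] -/
theorem image_Jinf (i : ℕ) : P.T i '' P.Jinf z (i + 1) = P.Jinf z i := by
  haveI := hfin i
  haveI := hfin (i + 1)
  obtain ⟨N, hN⟩ := P.J_stable z i (hY i)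
  obtain ⟨N', hN'⟩ := P.J_stable z (i + 1) (hY (i + 1))
  rw [P.Jinf_eq_of_stable z hN' (le_max_right N N'),
    P.Jinf_eq_of_stable z hN ((le_max_left N N').trans (Nat.le_succ _)), ← J_succ]

/-! ### A compatible family of bounding cochains, and the conclusion -/

/-- A bounding cochain in the stable image at level `i` (the type carried through the recursion).
[cite: NeukirchSchmidtWingberg2008, Thm (2.7.5)] -/
structure StableCochainAt (i : ℕ) where
  /-- the cochain -/
  cochain : C(G, P.obj i)
  /-- it lies in the stable image -/
  mem : cochain ∈ P.Jinf z i

/-- The recursion step: a preimage in `J_∞(i+1)` of a cochain in `J_∞(i)`.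
[cite: NeukirchSchmidtWingberg2008, Thm (2.7.5)] -/
theorem exists_stableStep (i : ℕ) (prev : P.StableCochainAt z i) :
    ∃ b : C(G, P.obj (i + 1)), b ∈ P.Jinf z (i + 1) ∧ P.T i b = prev.cochain := by
  have h := prev.mem
  rw [← P.image_Jinf z hfin hY i] at h
  obtain ⟨b, hb, hbe⟩ := h
  exact ⟨b, hb, hbe⟩

/-- The recursion step as data. [cite: NeukirchSchmidtWingberg2008, Thm (2.7.5)] -/
def stableStep (i : ℕ) (prev : P.StableCochainAt z i) : P.StableCochainAt z (i + 1) :=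
  ⟨(P.exists_stableStep z hfin hY i prev).choose, (P.exists_stableStep z hfin hY i prev).choose_spec.1⟩

/-- The step maps down to the previous cochain. [cite: NeukirchSchmidtWingberg2008, Thm (2.7.5)] -/
theorem T_stableStep (i : ℕ) (prev : P.StableCochainAt z i) :
    P.T i (P.stableStep z hfin hY i prev).cochain = prev.cochain :=
  (P.exists_stableStep z hfin hY i prev).choose_spec.2

/-- A compatible family of bounding cochains, by recursion through the stable images.
[cite: NeukirchSchmidtWingberg2008, Thm (2.7.5)] -/
def stableCochains : ∀ i : ℕ, P.StableCochainAt z i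
  | 0 => ⟨(P.Jinf_nonempty z hfin hY 0).some, (P.Jinf_nonempty z hfin hY 0).some_mem⟩
  | i + 1 => P.stableStep z hfin hY i (stableCochains i)

/-- The family is compatible on the nose. [cite: NeukirchSchmidtWingberg2008, Thm (2.7.5)] -/
theorem T_stableCochains_succ (i : ℕ) :
    P.T i (P.stableCochains z hfin hY (i + 1)).cochain = (P.stableCochains z hfin hY i).cochain :=
  P.T_stableStep z hfin hY i _

/-- If the `2`-cocycle `z` of `X = lim X_i` bounds at every level and the `H¹(G, X_i)` are finite,
then `z` bounds: `z = ∂ b` for a continuous `b : G → X`.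
[cite: NeukirchSchmidtWingberg2008, Cor (2.7.6)] -/
theorem exists_bounding_cochain :
    ∃ b : C(G, X), ∀ σ τ : G, z.1 (σ, τ) = X.ρ σ (b τ) - b (σ * τ) + b σ := by
  obtain ⟨F, hF⟩ := P.exists_continuousMap_lift (fun i => (P.stableCochains z hfin hY i).cochain)
    fun i g => by rw [← T_apply, P.T_stableCochains_succ z hfin hY i]
  refine ⟨F, fun σ τ => P.proj_injective _ _ fun i => ?_⟩
  rw [map_add, map_sub, TopRep.hom_comm_apply, hF, hF, hF]
  exact P.Jinf_subset_Y z i (P.stableCochains z hfin hY i).mem σ τ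

omit hY

variable [LocallyCompactSpace G]

/-- **Injectivity of `H²(G, lim X_i) → lim H²(G, X_i)`** when the `H¹(G, X_i)` are finite
(Mittag-Leffler: `lim¹ H¹(G, X_i) = 0`).
[cite: NeukirchSchmidtWingberg2008, Cor (2.7.6)] -/
theorem toLimitClasses_injective : Injective P.toLimitClasses := by
  refine (injective_iff_map_eq_zero _).2 fun c hc => ?_
  obtain ⟨z, rfl⟩ := twoCocycleClass_surjective X c
  have hY : ∀ i, (P.Y z i).Nonempty := fun i => by
    have h := congrArg (fun s : P.limitClasses => (s : ∀ i, continuousCohomology 2 (P.obj i)) i) hc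
    change (P.toLimitClasses (twoCocycleClass X z) : ∀ i, continuousCohomology 2 (P.obj i)) i = 0 at h
    rw [toLimitClasses_twoCocycleClass, twoCocycleClass_eq_zero_iff] at h
    obtain ⟨b, hb⟩ := h
    exact ⟨b, fun σ τ => hb σ τ⟩
  exact (twoCocycleClass_eq_zero_iff X z).2 (P.exists_bounding_cochain z hfin hY)

/-- **`H²(G, lim_{← i} X_i) ≅ lim_{← i} H²(G, X_i)`** for an `ℕ`-tower of discrete topological
representations with surjective transition maps and finite `H¹(G, X_i)` — continuous cochain
cohomology commutes with the inverse limit in degree `2` (Neukirch–Schmidt–Wingberg (2.7.5) with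
`lim¹ H¹ = 0`, Cor. (2.7.6); e.g. `H²(G_K, ℤ_ℓ(1)) = lim H²(G_K, μ_{ℓ^i})`,
`H²(G_K, Ẑ(1)) = lim H²(G_K, μ_{n!})` for a `p`-adic field `K`).
[cite: NeukirchSchmidtWingberg2008, Cor (2.7.6)] -/
def limitClassesEquiv : continuousCohomology 2 X ≃+ P.limitClasses :=
  AddEquiv.ofBijective P.toLimitClasses ⟨P.toLimitClasses_injective hfin, P.toLimitClasses_surjective⟩

/-- Components of `limitClassesEquiv`. [cite: NeukirchSchmidtWingberg2008, Cor (2.7.6)] -/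
@[simp] theorem limitClassesEquiv_apply_coe (c : continuousCohomology 2 X) (i : ℕ) :
    (P.limitClassesEquiv hfin c : ∀ i, continuousCohomology 2 (P.obj i)) i =
      (cohomologyMap (P.proj i) 2).hom c := rfl

end DiscreteTowerPresentation

end Literature.NumberTheory.GaloisRepresentations

end
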